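import Summits.BirchSwinnertonDyer.BirchSwinnertonDyer.Theorems.QuadraticBranchSignedControlPlusEtaLowerInclusionPrimeCofactorAlgebra
import Summits.BirchSwinnertonDyer.BirchSwinnertonDyer.Theorems.QuadraticBranchSignedControlPlusEtaR0KuriharaRecords06
import HarnessLib

/-!
# Route `QuadraticBranchSignedControl` (rung K8, cell `bsd-potss`), crux `PlusEtaLowerInclusion`
# (item stmt-BirchSwinnertonDyer-19601): the PRIME-COFACTOR SQUEEZE, part 2 — the road (ONE factor of `p` +
# a PRIME cofactor `L_p⁺(V,η,T)/T^r`, no functional equation) and the last rank-zero residue row `288600bn1`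
# re-certified WITHOUT a Kurihara number (seat `bsd-potss-k8eta-c1` g12; `--supports` 19601)

WHAT. §2 `quadraticBranchPlusEtaLowerInclusionAt_of_namedFacts_of_primeCofactor_of_torsionDvd` (+ pair): at a
tower-onto good `a_p = 0` pair, GRANTED Kobayashi 1.2/1.3/2.2η/4.1η and Kitajima–Otsuki 1.3η (NAMED facts — NOT
B. D. Kim's functional equation), the `V`-certificate, the DISPLAYED analytic TOP-SEGMENT certificate of length
`d ≥ 2` on `L_p⁺(V,η,T)` (`p^{d−1} ∥ coeff_r`, `p^{d−i} ∣ coeff_{r+i}` for `0 < i < d`, `p ∤ coeff_{r+d}`; `r = rank W`;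
unit-invariant) and ONE factor of `p` in `#(X_η/TX_η)_tors`: (E⁺_η) ∧ (C1⁺_η) — Kato side `ξ ∣ L`, rank bound
`T^r ∣ ξ`, `p ∣ coeff_r ξ`, and part 1's `prime_of_topSegment_coeff` + `span_singleton_eq_of_prime_cofactor`.
§3 the record shape over a kernel Tate row certificate (`1 + r ≤ |L|` Tamagawa-`p` primes, torsion slot `a = 1` by
gen 4's Tamagawa road) and the RECORD `PlusEtaR0PrimeCofactorRows.etaPair_r0_v288600bn1_5_of_topSegment`:
(E⁺_η) ∧ (C1⁺_η) at `5` for every tower-onto twist of `288600bn1` from {Kob 1.2/1.3/2.2η/4.1η, KO 1.3η, PT} + the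
kernel row certificate of gen 5 (`PlusEtaR0Kurihara.rowCheck_v288600bn1`, single Tamagawa-`5` prime `13`,
`c₁₃ = 10`) + DISPLAYED {`rank W = 0`, tower onto, `V`-certificate, top-segment certificate of length `4`}. The
row's previous record (`PlusEtaR0Rows.etaPair_r0_v288600bn1_5`, gen 5) needed Kim 2026 Thm. 1.8 (6) at LEVEL 2,
Cremona's Manin datum and a level-2 Kurihara number mod 25; this one needs none of them (and no `Ш` input: the one
Tamagawa factor sees one zero of the prime quartic cofactor, which has no proper divisor to retreat to).
EVIDENCE for the displayed analytic binder (kit, `--workitem` 19601): j305787 / j306125 — engine B (gen 11's exact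
η-twisted Mazur–Tate elements of `V` = the `5`-twist of `288600bn1`, conductor `11544`, eclib modular symbols) at
levels `5⁸, 5⁹, 5¹⁰`: `5`-adic valuations of the `H_η` coefficients `k = 0..4` = `[2, 2, 3, 2, −1]` at `n = 8, 9`
(`[2,2,2,2,−1]` at `n = 7`), i.e. relative to the `λ`-coefficient `[3, 3, 4, 3, 0]` ⊇ the required `[=3, ≥3, ≥2, ≥1, =0]`;
PARI `ellpadiclambdamu` `[λ⁺, μ⁺] = [4, 0]` and `v_an = 3 = ord₅ #Ш_an + ord₅ Tam` (gen 3 table) agree.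

HONEST FRAMING (cell `bsd-potss`, run/shared/lean/pub/bsd-potss/; FULL-BSD rank ≤ 1 programme, HUMAN RULING
D-0036/D-0074): TOOL THEOREMS + ONE per-row instance, CONDITIONAL on the named Literature facts in hypothesis
position and on displayed per-pair inputs. Crux 19601 is OPEN class-wide and NOT closed; nothing is booked;
`BSD(W, p)` is claimed for no pair; census tally 40/40 UNCHANGED (a second, lighter certificate for one row). No
definition, no named fact, no `sorry`, axioms standard.

References: [Kobayashi2003] Thm. 2.2 (p. 5), §4 + Thm. 4.1 (p. 8), Thm. 9.3; [KitajimaOtsuki2018] Thm. 1.3;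
[MilneADT2006] I Thm. 4.10; [Washington1997] §7.1, §13.2; [SilvermanATAEC1994] IV.9.4; [Cremona1997] Table 1.
-/

set_option autoImplicit false
set_option linter.dupNamespace false

noncomputable section

open scoped Classical

open Polynomial
open Literature.NumberTheory.EllipticCurves
open Literature.NumberTheory.EllipticCurves.IwasawaDual
open Literature.NumberTheory.EllipticCurves.IwasawaAlgebra

namespace Summit.BirchSwinnertonDyer.BirchSwinnertonDyer.Theorems

/-! ## §2 The road: (E⁺_η) ∧ (C1⁺_η) from a PRIME cofactor and ONE factor of `p` — no functional equation -/

section Pair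

open CongruenceSubgroup Field NumberField IsDedekindDomain WeierstrassCurve
open Literature.NumberTheory.EllipticCurves.ModularForms
open Literature.NumberTheory.GaloisRepresentations
open Literature.NumberTheory.GaloisCohomology
open Summit.BirchSwinnertonDyer.Rank1Residual.Additive

variable {V : WeierstrassCurve ℚ} [V.IsElliptic] [V.IsGloballyMinimal] {p : ℕ} [hp : Fact p.Prime]

/-- **(E⁺_η) AT A TOWER-ONTO PAIR — the prime-cofactor squeeze.** GRANTED Kobayashi's Thm. 1.2 / 1.3 /
2.2(η) / 4.1(η) and Kitajima–Otsuki's Thm. 1.3 at `η` (NAMED facts; NO functional equation), on a good `a_p = 0`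
pair with `p ≥ 5`, `ρ_{V,p^m}` onto, the `V`-certificate, the ANALYTIC TOP-SEGMENT certificate `hanNP` of length
`d ≥ 2` (`p^{d−1} ∥ coeff_r`, `p^{d−i} ∣ coeff_{r+i}` for `0 < i < d`, `p ∤ coeff_{r+d}` of `L_p⁺(V,η,T)`,
`r = rank V^{(p*)}(ℚ)`, for every branch function — the conditions are unit-invariant) and the ALGEBRAIC input
`htors` (`p ∣ #(X_η/TX_η)_tors` for every `η`-datum — ONE factor of `p`): (E⁺_η)(V, p). Proof: Kato side
`ξ ∣ L`, rank bound `T^r ∣ ξ`, leading coefficient `p ∣ coeff_r ξ` (as in the valuation squeeze), and the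
cofactor `L/T^r` is PRIME (`PrimeCofactor.prime_of_topSegment_coeff`), so `ξ/T^r` is a unit (excluded) or the
whole cofactor. CONDITIONAL; closes nothing class-wide.
[cite: Kobayashi2003, Thm. 2.2 (p. 5), Thm. 4.1 and §4 (p. 8)] [cite: KitajimaOtsuki2018, Thm. 1.3]
[cite: Washington1997, §7.1 Thm. 7.3 and §13.2] -/
theorem quadraticBranchPlusEtaLowerInclusionAt_of_namedFacts_of_primeCofactor_of_torsionDvd
    (h12 : Kobayashi2003.thm12_signedSelmerDual_finite_torsion)
    (h13 : Kobayashi2003.thm41_signedCharIdeal_divisibility)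
    (h22 : Kobayashi2003.thm22_etaSignedSelmerDual_finite_torsion)
    (h41 : Kobayashi2003.thm41_plusEtaCharIdeal_dvd)
    (hKO : KitajimaOtsuki2018.mainThm13_etaSignedSelmerDual_noFiniteSubmodule)
    (hp5 : 5 ≤ p) (hgood : V.HasGoodReductionAtPrime p) (hap : V.frobeniusTrace p = 0)
    (hsurj : ∀ m : ℕ, V.HasSurjectiveModNGaloisRep (p ^ m : ℕ))
    (hcertV : ∀ {N : ℕ} [NeZero N] (f : CuspForm (Gamma0 N) 2), IsNewformOf V f →
      ∃ L : IwasawaAlgebra p, Kobayashi2003.IsSignedPAdicLFunction f p 1 L ∧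
        IsUnit (PowerSeries.coeff V.mordellWeilRank L))
    (d : ℕ) (hd2 : 2 ≤ d)
    (hanNP : ∀ {N : ℕ} [NeZero N] {f : CuspForm (Gamma0 N) 2}, IsNewformOf V f →
      ∀ (ϖ : ℚ), (if Even (p / 2) then (ϖ : ℝ) * V.realPeriodRat = plusPeriod f
          else (ϖ : ℝ) * V.imaginaryPeriodRat = minusPeriod f) →
      ∀ (Lη : IwasawaAlgebra p), IsQuadraticBranchPlusLFunction f p ϖ Lη →
        (p : ℤ_[p]) ^ (d - 1) ∣ PowerSeries.coeff (V.quadraticTwist ((-1) ^ (p / 2) * p)).mordellWeilRank Lη ∧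
        ¬ (p : ℤ_[p]) ^ d ∣ PowerSeries.coeff (V.quadraticTwist ((-1) ^ (p / 2) * p)).mordellWeilRank Lη ∧
        (∀ i, 0 < i → i < d → (p : ℤ_[p]) ^ (d - i) ∣
          PowerSeries.coeff ((V.quadraticTwist ((-1) ^ (p / 2) * p)).mordellWeilRank + i) Lη) ∧
        ¬ (p : ℤ_[p]) ∣ PowerSeries.coeff ((V.quadraticTwist ((-1) ^ (p / 2) * p)).mordellWeilRank + d) Lη)
    (htors : ∀ (K₀ : Type) [Field K₀] [NumberField K₀] [IsCyclotomicExtension {p} ℚ K₀]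
      [(galRange (K := ℚ) K₀).Normal] (ηq : absoluteGaloisGroup ℚ →* ℤˣ),
      (∀ σ ∈ galRange (K := ℚ) K₀, ηq σ = 1) → ηq ≠ 1 →
      ∀ (κ : ZpExtension ℚ p) (γ : absoluteGaloisGroup ℚ),
        κ.IsCyclotomic → κ.IsTopGenerator γ → γ ∈ galRange (K := ℚ) K₀ → IsCyclotomicVariable p γ →
      ∀ {N : ℕ} [NeZero N] {f : CuspForm (Gamma0 N) 2}, IsNewformOf V f →
      ∀ (ϖ : ℚ), (if Even (p / 2) then (ϖ : ℝ) * V.realPeriodRat = plusPeriod f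
          else (ϖ : ℝ) * V.imaginaryPeriodRat = minusPeriod f) →
      ∀ (Lη : IwasawaAlgebra p), IsQuadraticBranchPlusLFunction f p ϖ Lη →
        PowerSeries.coeff (V.quadraticTwist ((-1) ^ (p / 2) * p)).mordellWeilRank Lη ≠ 0 →
      ∀ (D : EtaSignedSelmerDualData V κ K₀ ℚ_[p] ηq γ 1),
        p ∣ Nat.card (AddCommGroup.torsion (IwasawaAlgebra.coinvariants p D.X))) :
    QuadraticBranchPlusEtaLowerInclusionAt V p := by
  intro K₀ _ _ _ _ ηq hηK hη1 N _ f hp2 hgood' hap' hf ϖ hϖ Lη hL κ γ hκ hγ hγK hγc D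
  obtain ⟨hfin, htor⟩ :=
    EtaSignedSelmerDualData.finite_isTorsion_of_thm22 h22 hηK hp2 hgood' hap' hκ hγ hγK D
  haveI : Module.Finite (IwasawaAlgebra p) D.X := hfin
  obtain ⟨g, hg⟩ := (charIdeal_isPrincipal_holds p D.X).principal
  have hg' : D.charIdeal = Ideal.span {g} := hg
  -- Kato side: `g ∣ Lη`
  obtain ⟨-, hup⟩ := EtaSignedSelmerDualData.thm41_plus_of_facts h22 h41 hηK hη1 hp2 hgood' hap' hf
    ϖ hϖ Lη hL hκ hγ hγK hγc D
  have hgL : g ∣ Lη := by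
    have h := hup hsurj
    rw [hg', Ideal.span_singleton_le_span_singleton] at h
    exact h
  obtain ⟨hr0, hr0', hri, hrd⟩ := hanNP hf ϖ hϖ Lη hL
  set r := (V.quadraticTwist ((-1) ^ (p / 2) * p)).mordellWeilRank with hr
  have hne : PowerSeries.coeff r Lη ≠ 0 := fun h0 => hr0' (by rw [h0]; exact dvd_zero _)
  -- rank bound, leading coefficient, torsion divisibility: `p ∣ coeff_r g`
  have hXg := X_pow_twistRank_dvd_etaCharGenerator_of_namedFacts_of_certV h12 h13 h22 hp5 hgood hap
    hsurj (fun f hf => hcertV f hf) hf K₀ ηq hηK hη1 κ γ hκ hγ hγK hγc D hg'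
  obtain ⟨w, hw⟩ := coeff_twistRank_etaCharGenerator_eq_unit_mul_card_coker_bockstein h12 h13 h22 h41
    hKO hp5 hgood hap hsurj (fun f hf => hcertV f hf) hf ϖ hϖ Lη hL hne K₀ ηq hηK hη1 κ γ hκ hγ hγK hγc
    D hg'
  obtain ⟨-, hdvd⟩ := ker_bockstein_eq_bot_and_natCard_torsion_coinvariants_dvd h12 h13 h22 h41 hKO
    hp5 hgood hap hsurj (fun f hf => hcertV f hf) hf ϖ hϖ Lη hL hne K₀ ηq hηK hη1 κ γ hκ hγ hγK hγc D
  have hcoef : (p : ℤ_[p]) ∣ PowerSeries.coeff r g := by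
    rw [hw]
    obtain ⟨c, hc⟩ := (htors K₀ ηq hηK hη1 κ γ hκ hγ hγK hγc hf ϖ hϖ Lη hL hne D).trans hdvd
    refine Dvd.dvd.mul_left ?_ _
    rw [hc, Nat.cast_mul]
    exact dvd_mul_right _ _
  -- the cofactor `M = Lη / T^r` and its top segment
  have hXL : (PowerSeries.X : IwasawaAlgebra p) ^ r ∣ Lη := hXg.trans hgL
  obtain ⟨M, hLM⟩ := hXL
  have hMc : ∀ i, PowerSeries.coeff i M = PowerSeries.coeff (r + i) Lη := by
    intro i
    rw [hLM, PowerSeries.coeff_X_pow_mul', if_pos (Nat.le_add_right r i), Nat.add_sub_cancel_left]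
  have hM0 : PowerSeries.coeff 0 M = PowerSeries.coeff r Lη := by rw [hMc, Nat.add_zero]
  have hMprime : Prime M := by
    refine PrimeCofactor.prime_of_topSegment_coeff p hd2 ?_ ?_ ?_ ?_
    · rw [hMc]; exact hrd
    · intro i hi hid; rw [hMc]; exact hri i hi hid
    · rw [hM0]; exact hr0
    · rw [hM0]; exact hr0'
  have heq : Ideal.span {g} = Ideal.span {Lη} :=
    PrimeCofactor.span_singleton_eq_of_prime_cofactor p hXg hgL hLM hMprime hcoef
  rw [← heq, ← hg']

/-- **(E⁺_η) ∧ (C1⁺_η) at a tower-onto pair by the prime-cofactor squeeze.** CONDITIONAL; closes nothing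
class-wide. [cite: Kobayashi2003, §4 and Thm. 4.1 (p. 8)] [cite: Washington1997, §7.1 Thm. 7.3] -/
theorem quadraticBranchPlusEta_pair_of_namedFacts_of_primeCofactor_of_torsionDvd
    (h12 : Kobayashi2003.thm12_signedSelmerDual_finite_torsion)
    (h13 : Kobayashi2003.thm41_signedCharIdeal_divisibility)
    (h22 : Kobayashi2003.thm22_etaSignedSelmerDual_finite_torsion)
    (h41 : Kobayashi2003.thm41_plusEtaCharIdeal_dvd)
    (hKO : KitajimaOtsuki2018.mainThm13_etaSignedSelmerDual_noFiniteSubmodule)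
    (hp5 : 5 ≤ p) (hgood : V.HasGoodReductionAtPrime p) (hap : V.frobeniusTrace p = 0)
    (hsurj : ∀ m : ℕ, V.HasSurjectiveModNGaloisRep (p ^ m : ℕ))
    (hcertV : ∀ {N : ℕ} [NeZero N] (f : CuspForm (Gamma0 N) 2), IsNewformOf V f →
      ∃ L : IwasawaAlgebra p, Kobayashi2003.IsSignedPAdicLFunction f p 1 L ∧
        IsUnit (PowerSeries.coeff V.mordellWeilRank L))
    (d : ℕ) (hd2 : 2 ≤ d)
    (hanNP : ∀ {N : ℕ} [NeZero N] {f : CuspForm (Gamma0 N) 2}, IsNewformOf V f →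
      ∀ (ϖ : ℚ), (if Even (p / 2) then (ϖ : ℝ) * V.realPeriodRat = plusPeriod f
          else (ϖ : ℝ) * V.imaginaryPeriodRat = minusPeriod f) →
      ∀ (Lη : IwasawaAlgebra p), IsQuadraticBranchPlusLFunction f p ϖ Lη →
        (p : ℤ_[p]) ^ (d - 1) ∣ PowerSeries.coeff (V.quadraticTwist ((-1) ^ (p / 2) * p)).mordellWeilRank Lη ∧
        ¬ (p : ℤ_[p]) ^ d ∣ PowerSeries.coeff (V.quadraticTwist ((-1) ^ (p / 2) * p)).mordellWeilRank Lη ∧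
        (∀ i, 0 < i → i < d → (p : ℤ_[p]) ^ (d - i) ∣
          PowerSeries.coeff ((V.quadraticTwist ((-1) ^ (p / 2) * p)).mordellWeilRank + i) Lη) ∧
        ¬ (p : ℤ_[p]) ∣ PowerSeries.coeff ((V.quadraticTwist ((-1) ^ (p / 2) * p)).mordellWeilRank + d) Lη)
    (htors : ∀ (K₀ : Type) [Field K₀] [NumberField K₀] [IsCyclotomicExtension {p} ℚ K₀]
      [(galRange (K := ℚ) K₀).Normal] (ηq : absoluteGaloisGroup ℚ →* ℤˣ),
      (∀ σ ∈ galRange (K := ℚ) K₀, ηq σ = 1) → ηq ≠ 1 →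
      ∀ (κ : ZpExtension ℚ p) (γ : absoluteGaloisGroup ℚ),
        κ.IsCyclotomic → κ.IsTopGenerator γ → γ ∈ galRange (K := ℚ) K₀ → IsCyclotomicVariable p γ →
      ∀ {N : ℕ} [NeZero N] {f : CuspForm (Gamma0 N) 2}, IsNewformOf V f →
      ∀ (ϖ : ℚ), (if Even (p / 2) then (ϖ : ℝ) * V.realPeriodRat = plusPeriod f
          else (ϖ : ℝ) * V.imaginaryPeriodRat = minusPeriod f) →
      ∀ (Lη : IwasawaAlgebra p), IsQuadraticBranchPlusLFunction f p ϖ Lη →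
        PowerSeries.coeff (V.quadraticTwist ((-1) ^ (p / 2) * p)).mordellWeilRank Lη ≠ 0 →
      ∀ (D : EtaSignedSelmerDualData V κ K₀ ℚ_[p] ηq γ 1),
        p ∣ Nat.card (AddCommGroup.torsion (IwasawaAlgebra.coinvariants p D.X))) :
    QuadraticBranchPlusEtaLowerInclusionAt V p ∧ QuadraticBranchPlusEtaMainConjectureAt V p := by
  have hE : QuadraticBranchPlusEtaLowerInclusionAt V p :=
    quadraticBranchPlusEtaLowerInclusionAt_of_namedFacts_of_primeCofactor_of_torsionDvd h12 h13 h22 h41 hKO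
      hp5 hgood hap hsurj (fun f hf => hcertV f hf) d hd2 (fun hf => hanNP hf) htors
  exact ⟨hE, quadraticBranchPlusEtaMainConjectureAt_of_facts_of_surjective_of_etaLowerInclusion h22 h41
    hsurj hE⟩

end Pair

/-! ## §3 Record shape (row certificate, `1 + r ≤ |L|`) and the last rank-zero residue row `288600bn1` -/

section Record

open CongruenceSubgroup Field NumberField IsDedekindDomain WeierstrassCurve
open Literature.NumberTheory.EllipticCurves.ModularForms
open Literature.NumberTheory.GaloisRepresentations
open Literature.NumberTheory.GaloisCohomology
open Summit.BirchSwinnertonDyer.Rank1Residual.Additive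
open Summit.BirchSwinnertonDyer.BirchSwinnertonDyer.Rank2Observatory.Tam

variable {p : ℕ} [hp : Fact p.Prime]

/-- **RECORD SHAPE — (E⁺_η) ∧ (C1⁺_η) on a Tamagawa row by the prime-cofactor squeeze.** GRANTED the named facts
(Kobayashi 1.2/1.3/2.2η/4.1η, Kitajima–Otsuki 1.3η, Poitou–Tate; NO functional equation), `p ≥ 5`, an integer
equation `W₀` with a PASSING ROW CERTIFICATE `Es` and a list `L` of listed primes `≠ p` with exact certified values
`c`, `p ∥ c`, every other listed prime `≠ p` having certified values prime to `p`, `W = W₀ ⊗ ℚ` globally minimal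
with `rank W(ℚ) + 1 ≤ |L|` (the rank DISPLAYED): for every globally minimal `V` with `C • W^{(p*)} = V`, good at `p`,
`a_p(V) = 0`, `ρ_{V,p^m}` onto, the `V`-certificate and the ANALYTIC TOP-SEGMENT certificate of length `d ≥ 2`:
(E⁺_η)(V,p) ∧ (C1⁺_η)(V,p) (torsion slot `a = 1` by the Tamagawa road, `1 + r ≤ ∑_T ord_p c`). CONDITIONAL; closes
nothing class-wide. [cite: Kobayashi2003, Thm. 2.2 (p. 5), §4 and Thm. 4.1 (p. 8), Thm. 9.3] [cite: KitajimaOtsuki2018, Thm. 1.3]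
[cite: MilneADT2006, Ch. I, Thm. 4.10] [cite: SilvermanATAEC1994, IV.9.4] [cite: Washington1997, §7.1 Thm. 7.3] -/
theorem etaPair_of_rowCheck_of_tamagawa_of_primeCofactor
    (h12 : Kobayashi2003.thm12_signedSelmerDual_finite_torsion)
    (h13 : Kobayashi2003.thm41_signedCharIdeal_divisibility)
    (h22 : Kobayashi2003.thm22_etaSignedSelmerDual_finite_torsion)
    (h41 : Kobayashi2003.thm41_plusEtaCharIdeal_dvd)
    (hKO : KitajimaOtsuki2018.mainThm13_etaSignedSelmerDual_noFiniteSubmodule)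
    (hPT : poitouTate_selmerStructure_duality_real ℚ) (hp5 : 5 ≤ p)
    {Es : List TamLocal} {W₀ : WeierstrassCurve ℤ} (hrow : TamLocal.rowCheck Es W₀ = true)
    (L : List ℕ) (hout : ∀ E ∈ Es, E.p ∉ L → E.p = p ∨ ∀ c ∈ E.vals, ¬ p ∣ c)
    (hin : ∀ E ∈ Es, E.p ∈ L → E.vals = [E.c] ∧ p ∣ E.c ∧ ¬ p ^ 2 ∣ E.c)
    (hL : ∀ ℓ ∈ L, ℓ ∈ Es.map (·.p)) (hnd : L.Nodup) (hpL : p ∉ L)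
    [(W₀.baseChange ℚ).IsElliptic] [hGM : (W₀.baseChange ℚ).IsGloballyMinimal]
    (hrk : (W₀.baseChange ℚ).mordellWeilRank + 1 ≤ L.length)
    (V : WeierstrassCurve ℚ) [V.IsElliptic] [V.IsGloballyMinimal] (C : VariableChange ℚ)
    (hCV : C • (W₀.baseChange ℚ).quadraticTwist ((-1) ^ (p / 2) * p) = V)
    (hgood : V.HasGoodReductionAtPrime p) (hap : V.frobeniusTrace p = 0)
    (hsurj : ∀ m : ℕ, V.HasSurjectiveModNGaloisRep (p ^ m : ℕ))
    (hcertV : ∀ {N : ℕ} [NeZero N] (f : CuspForm (Gamma0 N) 2), IsNewformOf V f →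
      ∃ L : IwasawaAlgebra p, Kobayashi2003.IsSignedPAdicLFunction f p 1 L ∧
        IsUnit (PowerSeries.coeff V.mordellWeilRank L))
    (d : ℕ) (hd2 : 2 ≤ d)
    (hanNP : ∀ {N : ℕ} [NeZero N] {f : CuspForm (Gamma0 N) 2}, IsNewformOf V f →
      ∀ (ϖ : ℚ), (if Even (p / 2) then (ϖ : ℝ) * V.realPeriodRat = plusPeriod f
          else (ϖ : ℝ) * V.imaginaryPeriodRat = minusPeriod f) →
      ∀ (Lη : IwasawaAlgebra p), IsQuadraticBranchPlusLFunction f p ϖ Lη →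
        (p : ℤ_[p]) ^ (d - 1) ∣ PowerSeries.coeff (V.quadraticTwist ((-1) ^ (p / 2) * p)).mordellWeilRank Lη ∧
        ¬ (p : ℤ_[p]) ^ d ∣ PowerSeries.coeff (V.quadraticTwist ((-1) ^ (p / 2) * p)).mordellWeilRank Lη ∧
        (∀ i, 0 < i → i < d → (p : ℤ_[p]) ^ (d - i) ∣
          PowerSeries.coeff ((V.quadraticTwist ((-1) ^ (p / 2) * p)).mordellWeilRank + i) Lη) ∧
        ¬ (p : ℤ_[p]) ∣ PowerSeries.coeff ((V.quadraticTwist ((-1) ^ (p / 2) * p)).mordellWeilRank + d) Lη) :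
    QuadraticBranchPlusEtaLowerInclusionAt V p ∧ QuadraticBranchPlusEtaMainConjectureAt V p := by
  obtain ⟨hpT, hT, hT1, hsum⟩ := TamagawaRoad.tamagawa_inputs_of_rowCheck hrow hGM p L hout hin hL hnd hpL
  have hd0 : ((-1 : ℚ) ^ (p / 2) * p) ≠ 0 :=
    mul_ne_zero (pow_ne_zero _ (by norm_num)) (Nat.cast_ne_zero.mpr hp.out.ne_zero)
  have hr : (V.quadraticTwist ((-1) ^ (p / 2) * p)).mordellWeilRank = (W₀.baseChange ℚ).mordellWeilRank :=
    TamagawaRoad.mordellWeilRank_quadraticTwist_eq_of_smul_quadraticTwist_eq hd0 hCV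
  rw [TamagawaRoad.pl_eq_primesEquiv_symm p] at hpT hT
  refine quadraticBranchPlusEta_pair_of_namedFacts_of_primeCofactor_of_torsionDvd h12 h13 h22 h41 hKO hp5 hgood
    hap hsurj (fun f hf => hcertV f hf) d hd2 (fun hf => hanNP hf) ?_
  intro K₀ _ _ _ _ ηq hηK hη1 κ γ hκ hγ hγK hγc N _ f hf ϖ hϖ Lη hL' hne D
  have h := pow_dvd_natCard_torsion_coinvariants_of_namedFacts_of_poitouTate_of_tamagawa h12 h13 h22 h41 hPT
    hp5 hgood hap hsurj (fun f hf => hcertV f hf) hf ϖ hϖ Lη hL' hne (W₀.baseChange ℚ) C hCV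
    ((L.map pl).toFinset) hpT hT hT1 K₀ ηq hηK hη1 κ γ hκ hγ hγK hγc D 1 (by rw [hsum, hr]; omega)
  rwa [pow_one] at h

end Record

namespace PlusEtaR0PrimeCofactorRows

open CongruenceSubgroup Field NumberField IsDedekindDomain WeierstrassCurve
open Literature.NumberTheory.EllipticCurves.ModularForms
open Literature.NumberTheory.GaloisRepresentations
open Literature.NumberTheory.GaloisCohomology
open Summit.BirchSwinnertonDyer.Rank1Residual.Additive
open Summit.BirchSwinnertonDyer.BirchSwinnertonDyer.Rank2Observatory.Tam

/-- **(E⁺_η) ∧ (C1⁺_η) at `p = 5` for EVERY tower-onto good supersingular twist of `W = 288600bn1` — the LAST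
rank-zero residue row of the census — from ONE Tamagawa factor and a PRIME quartic cofactor** (Cremona's minimal
model `[0, −1, 0, −4235816083, −106109503819088]`, `N = 288600 = 5²·11544`, additive `I₀*` at `5`; `∏ c_ℓ = 80`,
`c₁₃ = 10`; `#Ш_an = 25`, `r_an = 0`). IN THE KERNEL: `Δ ≠ 0`, global minimality and the Tate row certificate of
gen 5 (`PlusEtaR0Kurihara.rowCheck_v288600bn1`) ⇒ the torsion slot `5 ∣ #(X_η/TX_η)_tors` from the single
Tamagawa-`5` prime `13`; the Λ-algebra (`PrimeCofactor.prime_of_topSegment_coeff`: Weierstrass + the Eisenstein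
transform of the top segment). DISPLAYED: `rank W(ℚ) = 0`; on `V`: tower onto, the `V`-certificate, and the
ANALYTIC TOP-SEGMENT CERTIFICATE of length `4` for `L_5⁺(V,η,T)` — `5³ ∥ coeff₀`, `5³ ∣ coeff₁`, `5² ∣ coeff₂`,
`5 ∣ coeff₃`, `5 ∤ coeff₄` — kit j305787 (engine B: exact η-twisted Mazur–Tate elements of `V`, conductor `11544`,
eclib modular symbols, level `5⁸`): valuations of the `H_η` component `[2, 2, 2, 2, −1, …]`, i.e. relative to the
`λ`-coefficient `[3, 3, 3, 3, 0]`; PARI `ellpadiclambdamu` `λ⁺ = 4` (g3 table); `v_an = ord₅ #Ш_an + ord₅ Tam = 3`.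
Newton polygon ONE segment `(0,3)–(4,0)`, `gcd(3,4) = 1`: the quartic cofactor is PRIME, so the one Tamagawa
factor forces `(ξ_η) = (L_5⁺(V,η,T))`. NAMED FACTS: Kobayashi 1.2/1.3/2.2η/4.1η, Kitajima–Otsuki 1.3η, Poitou–Tate
— NO Kim 1.8/1.11 (no Kurihara number of any level), NO functional equation, NO Manin constant, NO `Ш` input. A
per-row instance; nothing booked; `BSD(W,5)` not claimed; the class-wide crux is as open as before.
[cite: Kobayashi2003, §4 Even main conjecture and Thm. 4.1 (p. 8)] [cite: KitajimaOtsuki2018, Thm. 1.3]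
[cite: MilneADT2006, Ch. I, Thm. 4.10] [cite: Washington1997, §7.1 Thm. 7.3] [cite: Cremona1997, Table 1 (label 288600bn1)] -/
theorem etaPair_r0_v288600bn1_5_of_topSegment
    (h12 : Kobayashi2003.thm12_signedSelmerDual_finite_torsion)
    (h13 : Kobayashi2003.thm41_signedCharIdeal_divisibility)
    (h22 : Kobayashi2003.thm22_etaSignedSelmerDual_finite_torsion)
    (h41 : Kobayashi2003.thm41_plusEtaCharIdeal_dvd)
    (hKO : KitajimaOtsuki2018.mainThm13_etaSignedSelmerDual_noFiniteSubmodule)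
    (hPT : poitouTate_selmerStructure_duality_real ℚ)
    (W : WeierstrassCurve ℚ) (hW : W = ⟨0, -1, 0, (-4235816083), (-106109503819088)⟩)
    (hrW : W.mordellWeilRank = 0)
    (V : WeierstrassCurve ℚ) [V.IsElliptic] [V.IsGloballyMinimal] [Fact (5 : ℕ).Prime]
    (C : VariableChange ℚ) (hCV : C • W.quadraticTwist 5 = V)
    (hgood : V.HasGoodReductionAtPrime 5) (hap : V.frobeniusTrace 5 = 0)
    (hsurj : ∀ m : ℕ, V.HasSurjectiveModNGaloisRep (5 ^ m : ℕ))
    (hcertV : ∀ {N : ℕ} [NeZero N] (f : CuspForm (Gamma0 N) 2), IsNewformOf V f →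
      ∃ L : IwasawaAlgebra 5, Kobayashi2003.IsSignedPAdicLFunction f 5 1 L ∧
        IsUnit (PowerSeries.coeff V.mordellWeilRank L))
    (hanNP : ∀ {N : ℕ} [NeZero N] {f : CuspForm (Gamma0 N) 2}, IsNewformOf V f →
      ∀ (ϖ : ℚ), (if Even (5 / 2) then (ϖ : ℝ) * V.realPeriodRat = plusPeriod f
          else (ϖ : ℝ) * V.imaginaryPeriodRat = minusPeriod f) →
      ∀ (Lη : IwasawaAlgebra 5), IsQuadraticBranchPlusLFunction f 5 ϖ Lη →
        (5 : ℤ_[5]) ^ 3 ∣ PowerSeries.coeff 0 Lη ∧ ¬ (5 : ℤ_[5]) ^ 4 ∣ PowerSeries.coeff 0 Lη ∧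
        (∀ i, 0 < i → i < 4 → (5 : ℤ_[5]) ^ (4 - i) ∣ PowerSeries.coeff i Lη) ∧
        ¬ (5 : ℤ_[5]) ∣ PowerSeries.coeff 4 Lη) :
    QuadraticBranchPlusEtaLowerInclusionAt V 5 ∧ QuadraticBranchPlusEtaMainConjectureAt V 5 := by
  subst hW
  have hb := IntModelTam.baseChange_rat_mk_int 0 (-1) 0 (-4235816083) (-106109503819088)
  haveI : ((⟨0, -1, 0, (-4235816083), (-106109503819088)⟩ : WeierstrassCurve ℤ).baseChange ℚ).IsElliptic :=
    TamLocal.isElliptic_of_rowCheck PlusEtaR0Kurihara.rowCheck_v288600bn1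
  haveI : ((⟨0, -1, 0, (-4235816083), (-106109503819088)⟩ : WeierstrassCurve ℤ).baseChange ℚ).IsGloballyMinimal := by
    rw [hb]; exact PlusEtaR0Kurihara.isGloballyMinimal_v288600bn1
  have hD : ((-1 : ℚ) ^ ((5 : ℕ) / 2) * ((5 : ℕ) : ℚ)) = 5 := by norm_num
  have h5 : (5 : ℚ) ≠ 0 := by norm_num
  have hrk : (V.quadraticTwist 5).mordellWeilRank = 0 := by
    rw [TamagawaRoad.mordellWeilRank_quadraticTwist_eq_of_smul_quadraticTwist_eq h5 hCV, hrW]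
  refine etaPair_of_rowCheck_of_tamagawa_of_primeCofactor h12 h13 h22 h41 hKO hPT (le_refl 5)
    PlusEtaR0Kurihara.rowCheck_v288600bn1 [13] (by decide) (by decide) (by decide) (by decide) (by decide)
    (hrk := by rw [hb]; simp only [Int.cast_zero, Int.cast_neg, Int.cast_one, Int.cast_ofNat]; rw [hrW]; decide)
    V C (by rw [hb, hD]; exact hCV) hgood hap hsurj (fun f hf => hcertV f hf) 4 (by norm_num) ?_
  intro N _ f hf ϖ hϖ Lη hL
  rw [hD, hrk]
  simpa only [zero_add, Nat.cast_ofNat] using hanNP hf ϖ hϖ Lη hL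

end PlusEtaR0PrimeCofactorRows

end Summit.BirchSwinnertonDyer.BirchSwinnertonDyer.Theorems

end
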